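import Mathlib.Analysis.SpecialFunctions.SmoothTransition
import Mathlib.Analysis.SpecialFunctions.Trigonometric.Deriv
import Mathlib.Analysis.SpecialFunctions.Trigonometric.Bounds
import Mathlib.Analysis.InnerProductSpace.PiL2
import Mathlib.Analysis.Calculus.FDeriv.Mul
import Mathlib.Analysis.Calculus.Deriv.Mul
import Literature.Topology.FourManifolds.PlanarArch
import HarnessLib

/-!
# Holonomic approximation: smooth steps, plateaux, the cosine wiggle and shear maps

Topic `Literature/Topology/Immersions`; elementary real-analysis devices of the proof of the
**holonomic approximation theorem over a cube** (Eliashberg–Mishachev 2001, Lemma 1.3.2 /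
Thm. 1.3.1), continued from `HolonomicApproximationInterpolation.lean`:

* (reused) `Literature.Topology.FourManifolds.smoothStep a b` — the tree's `C^∞` step `ℝ → [0, 1]`,
  `= 0` on `(-∞, a]`, `= 1` on `[b, ∞)` (`PlanarArch.lean`).
* `Literature.Topology.Immersions.plateau N` — the cut-off `θ_N` of EM 2001 (proof of
  Lemma 1.3.2): `C^∞`, `[0, 1]`-valued, `= 0` on `(-∞, 1/(8N)] ∪ [1 - 1/(8N), ∞)` (in particular
  near `∂I`) and `= 1` on `[1/(4N), 1 - 1/(4N)]`.
* `Literature.Topology.Immersions.wiggle N δ₁` — the **wiggle**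
  `φ_N(t) = δ₁ θ_N(t) cos(2πN t)` (EM 2001, proof of Lemma 1.3.2, with `y`, `x` absent: the
  case of a `1`-dimensional cube): `C^∞`, `|φ_N| ≤ δ₁`, vanishing near `∂I` and outside `I`,
  equal to `(-1)ʲ δ₁` at the junction points `j/(2N)`, `1 ≤ j ≤ 2N - 1`, and bounded below in
  absolute value by `δ₁ cos(2πN w)` within distance `w ≤ 1/(4N)` of them
  (`abs_wiggle_ge_of_abs_sub_le`) — this is what puts the wiggled cube alternately in the top
  and bottom half-spaces where the interpolating sections are genuine members of the family.
* `Literature.Topology.Immersions.shear φ i j` — the **shear** `x ↦ x + φ(xᵢ) eⱼ` of `ℝⁿ`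
  along the coordinate `j ≠ i` (EM's `h(x) = (x₁, …, xₙ₋₁, xₙ + φ(x₁, …, x_k))`): a `C^∞`
  bijection with inverse the shear by `-φ`, moving points by `|φ(xᵢ)|`, with derivative
  `id + φ'(xᵢ) eⱼ ⊗ eᵢ*`.

Everything is **proved**; the three `def`s are explicit formulas with unfolding lemmas.

## References

* Y. Eliashberg, N. Mishachev, *Holonomic approximation and Gromov's h-principle*,
  arXiv:math/0101196 (2001), Thm. 1.3.1, Lemma 1.3.2 (proof). [EliashbergMishachev2001]
* Y. Eliashberg, N. Mishachev, *Introduction to the h-principle*, GSM 48, AMS (2002), Ch. 3.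
  [EliashbergMishachev2002]
-/

open Set Function Filter Metric Real
open scoped Topology ContDiff

noncomputable section

namespace Literature.Topology.Immersions

open Literature.Topology.FourManifolds (smoothStep smoothStep_of_le smoothStep_of_ge smoothStep_mem_Icc
  contDiff_smoothStep)

/-! ### The plateau cut-off `θ_N` -/

/-- The plateau cut-off `θ_N` (EM 2001, proof of Lemma 1.3.2): the product of a smooth step
rising on `[1/(8N), 1/(4N)]` and of the reflected one; it vanishes for `t ≤ 1/(8N)` and for
`t ≥ 1 - 1/(8N)` and equals `1` on `[1/(4N), 1 - 1/(4N)]`. [cite: EliashbergMishachev2001, Lemma 1.3.2] -/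
def plateau (N : ℕ) (t : ℝ) : ℝ :=
  smoothStep (1 / (8 * N)) (1 / (4 * N)) t * smoothStep (1 / (8 * N)) (1 / (4 * N)) (1 - t)

/-- Unfolding lemma for `plateau`. [cite: EliashbergMishachev2001, Lemma 1.3.2] -/
theorem plateau_apply (N : ℕ) (t : ℝ) : plateau N t =
    smoothStep (1 / (8 * N)) (1 / (4 * N)) t * smoothStep (1 / (8 * N)) (1 / (4 * N)) (1 - t) :=
  rfl

/-- `1/(8N) < 1/(4N)` for `0 < N`. [folklore] -/
theorem eighth_lt_quarter {N : ℕ} (hN : 0 < N) : (1 : ℝ) / (8 * N) < 1 / (4 * N) := by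
  have hN' : (0 : ℝ) < N := by exact_mod_cast hN
  exact one_div_lt_one_div_of_lt (by positivity) (by nlinarith)

/-- `plateau N` is `C^∞`. [folklore] -/
theorem contDiff_plateau (N : ℕ) {k : ℕ∞} : ContDiff ℝ k (plateau N) := by
  unfold plateau
  exact ((contDiff_smoothStep _ _).of_le (by exact_mod_cast le_top)).mul
    (((contDiff_smoothStep _ _).of_le (by exact_mod_cast le_top)).comp
      (contDiff_const.sub contDiff_id))

/-- `plateau N` is continuous. [folklore] -/
theorem continuous_plateau (N : ℕ) : Continuous (plateau N) :=
  (contDiff_plateau N (k := 0)).continuous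

/-- `0 ≤ plateau N t ≤ 1`. [folklore] -/
theorem plateau_mem_Icc (N : ℕ) (t : ℝ) : plateau N t ∈ Icc (0 : ℝ) 1 := by
  refine ⟨mul_nonneg (smoothStep_mem_Icc _ _ _).1 (smoothStep_mem_Icc _ _ _).1, ?_⟩
  exact mul_le_one₀ (smoothStep_mem_Icc _ _ _).2 (smoothStep_mem_Icc _ _ _).1
    (smoothStep_mem_Icc _ _ _).2

/-- `plateau N t = 0` for `t ≤ 1/(8N)` (`0 < N`): in particular near `t ≤ 0`. [folklore] -/
theorem plateau_of_le {N : ℕ} (hN : 0 < N) {t : ℝ} (ht : t ≤ 1 / (8 * N)) : plateau N t = 0 := by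
  rw [plateau_apply, smoothStep_of_le (eighth_lt_quarter hN) ht, zero_mul]

/-- `plateau N t = 0` for `1 - 1/(8N) ≤ t` (`0 < N`): in particular near `1 ≤ t`. [folklore] -/
theorem plateau_of_ge {N : ℕ} (hN : 0 < N) {t : ℝ} (ht : 1 - 1 / (8 * N) ≤ t) : plateau N t = 0 := by
  rw [plateau_apply, smoothStep_of_le (eighth_lt_quarter hN) (x := 1 - t) (by linarith),
    mul_zero]

/-- `plateau N t = 1` on `[1/(4N), 1 - 1/(4N)]` (`0 < N`). [folklore] -/
theorem plateau_of_mem {N : ℕ} (hN : 0 < N) {t : ℝ} (h₁ : 1 / (4 * N) ≤ t)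
    (h₂ : t ≤ 1 - 1 / (4 * N)) : plateau N t = 1 := by
  rw [plateau_apply, smoothStep_of_ge (eighth_lt_quarter hN) h₁,
    smoothStep_of_ge (eighth_lt_quarter hN) (x := 1 - t) (by linarith), mul_one]

/-! ### The wiggle `φ_N` -/

/-- The **wiggle** `φ_N(t) = δ₁ θ_N(t) cos(2πN t)` (EM 2001, proof of Lemma 1.3.2, in the case
of a one-dimensional cube: no `y`, `x` variables). [cite: EliashbergMishachev2001, Lemma 1.3.2] -/
def wiggle (N : ℕ) (δ₁ : ℝ) (t : ℝ) : ℝ :=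
  δ₁ * plateau N t * Real.cos (2 * π * N * t)

/-- Unfolding lemma for `wiggle`. [cite: EliashbergMishachev2001, Lemma 1.3.2] -/
theorem wiggle_apply (N : ℕ) (δ₁ t : ℝ) :
    wiggle N δ₁ t = δ₁ * plateau N t * Real.cos (2 * π * N * t) :=
  rfl

/-- The wiggle is `C^∞`. [folklore] -/
theorem contDiff_wiggle (N : ℕ) (δ₁ : ℝ) {k : ℕ∞} : ContDiff ℝ k (wiggle N δ₁) := by
  unfold wiggle
  exact (contDiff_const.mul (contDiff_plateau N)).mul
    (Real.contDiff_cos.comp (contDiff_const.mul contDiff_id))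

/-- The wiggle is continuous. [folklore] -/
theorem continuous_wiggle (N : ℕ) (δ₁ : ℝ) : Continuous (wiggle N δ₁) :=
  (contDiff_wiggle N δ₁ (k := 0)).continuous

/-- `|φ_N(t)| ≤ δ₁` (`0 ≤ δ₁`). [folklore] -/
theorem abs_wiggle_le (N : ℕ) {δ₁ : ℝ} (hδ₁ : 0 ≤ δ₁) (t : ℝ) : |wiggle N δ₁ t| ≤ δ₁ := by
  rw [wiggle_apply, abs_mul, abs_mul, abs_of_nonneg hδ₁,
    abs_of_nonneg (plateau_mem_Icc N t).1]
  calc δ₁ * plateau N t * |Real.cos (2 * π * N * t)| ≤ δ₁ * 1 * 1 := by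
        gcongr
        · exact (plateau_mem_Icc N t).2
        · exact Real.abs_cos_le_one _
    _ = δ₁ := by ring

/-- The wiggle vanishes for `t ≤ 1/(8N)`, in particular on a neighbourhood of `(-∞, 0]`.
[folklore] -/
theorem wiggle_of_le {N : ℕ} (hN : 0 < N) (δ₁ : ℝ) {t : ℝ} (ht : t ≤ 1 / (8 * N)) :
    wiggle N δ₁ t = 0 := by
  rw [wiggle_apply, plateau_of_le hN ht, mul_zero, zero_mul]

/-- The wiggle vanishes for `1 - 1/(8N) ≤ t`, in particular on a neighbourhood of `[1, ∞)`.
[folklore] -/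
theorem wiggle_of_ge {N : ℕ} (hN : 0 < N) (δ₁ : ℝ) {t : ℝ} (ht : 1 - 1 / (8 * N) ≤ t) :
    wiggle N δ₁ t = 0 := by
  rw [wiggle_apply, plateau_of_ge hN ht, mul_zero, zero_mul]

/-- `cos (2πN · j/(2N)) = (-1)ʲ`. [folklore] -/
theorem cos_two_pi_mul_junction {N : ℕ} (hN : 0 < N) (j : ℕ) :
    Real.cos (2 * π * N * (j / (2 * N))) = (-1) ^ j := by
  have hN' : (N : ℝ) ≠ 0 := by exact_mod_cast hN.ne'
  have : 2 * π * N * (j / (2 * N)) = j * π := by field_simp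
  rw [this, Real.cos_nat_mul_pi]

/-- **The wiggle at the junction points**: `φ_N(j/(2N)) = (-1)ʲ δ₁` for `1 ≤ j ≤ 2N - 1` (there
the plateau equals `1`). [cite: EliashbergMishachev2001, Lemma 1.3.2] -/
theorem wiggle_junction {N : ℕ} (hN : 0 < N) (δ₁ : ℝ) {j : ℕ} (hj₁ : 1 ≤ j) (hj₂ : j + 1 ≤ 2 * N) :
    wiggle N δ₁ (j / (2 * N)) = (-1) ^ j * δ₁ := by
  have hN' : (0 : ℝ) < N := by exact_mod_cast hN
  have hj₁' : (1 : ℝ) ≤ j := by exact_mod_cast hj₁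
  have hj₂' : (j : ℝ) + 1 ≤ 2 * N := by exact_mod_cast hj₂
  have h₁ : 1 / (4 * (N : ℝ)) ≤ j / (2 * N) := by
    have : (1 : ℝ) / (4 * N) = (1 / 2) / (2 * N) := by field_simp; ring
    rw [this]
    gcongr
    linarith
  have h₂ : (j : ℝ) / (2 * N) ≤ 1 - 1 / (4 * N) := by
    rw [div_le_iff₀ (by positivity : (0 : ℝ) < 2 * N)]
    have : (1 - 1 / (4 * (N : ℝ))) * (2 * N) = 2 * N - 1 / 2 := by field_simp; ring
    rw [this]
    linarith
  rw [wiggle_apply, plateau_of_mem hN h₁ h₂, cos_two_pi_mul_junction hN, mul_one, mul_comm]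

/-- Near a multiple of `π` the cosine is large: if `|u| ≤ v ≤ π` then `cos v ≤ |cos (jπ + u)|`
(the cosine is even and decreasing on `[0, π]`). [folklore] -/
theorem cos_le_abs_cos_nat_mul_pi_add {u v : ℝ} (j : ℕ) (hu : |u| ≤ v) (hv : v ≤ π) :
    Real.cos v ≤ |Real.cos (j * π + u)| := by
  rw [Real.cos_add, Real.cos_nat_mul_pi, Real.sin_nat_mul_pi, zero_mul, sub_zero, abs_mul,
    abs_pow, abs_neg, abs_one, one_pow, one_mul]
  calc Real.cos v ≤ Real.cos |u| := Real.cos_le_cos_of_nonneg_of_le_pi (abs_nonneg u) hv hu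
    _ = Real.cos u := Real.cos_abs u
    _ ≤ |Real.cos u| := le_abs_self _

/-- **The wiggle is large near the junctions** (EM 2001, proof of Lemma 1.3.2: the wiggled cube
lies in the top or bottom half-space near the junction slices). For `1 ≤ j ≤ 2N - 1`,
`w ≤ 1/(4N)` and `|t - j/(2N)| ≤ w`: `δ₁ cos(2πN w) ≤ |φ_N(t)|`.
[cite: EliashbergMishachev2001, Lemma 1.3.2] -/
theorem abs_wiggle_ge_of_abs_sub_le {N : ℕ} (hN : 0 < N) {δ₁ : ℝ} (hδ₁ : 0 ≤ δ₁) {j : ℕ}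
    (hj₁ : 1 ≤ j) (hj₂ : j + 1 ≤ 2 * N) {t w : ℝ} (hw : w ≤ 1 / (4 * N))
    (ht : |t - j / (2 * N)| ≤ w) :
    δ₁ * Real.cos (2 * π * N * w) ≤ |wiggle N δ₁ t| := by
  have hN' : (0 : ℝ) < N := by exact_mod_cast hN
  have hj₁' : (1 : ℝ) ≤ j := by exact_mod_cast hj₁
  have hj₂' : (j : ℝ) + 1 ≤ 2 * N := by exact_mod_cast hj₂
  have hw0 : 0 ≤ w := (abs_nonneg _).trans ht
  obtain ⟨htl, htu⟩ := abs_sub_le_iff.1 ht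
  -- `t` lies in the plateau region
  have hjl : 1 / (2 * (N : ℝ)) ≤ j / (2 * N) := by
    gcongr
  have hju : (j : ℝ) / (2 * N) ≤ 1 - 1 / (2 * N) := by
    rw [div_le_iff₀ (by positivity : (0 : ℝ) < 2 * N)]
    have : (1 - 1 / (2 * (N : ℝ))) * (2 * N) = 2 * N - 1 := by field_simp
    rw [this]
    linarith
  have hq : 1 / (2 * (N : ℝ)) - 1 / (4 * N) = 1 / (4 * N) := by field_simp; ring
  have h₁ : 1 / (4 * (N : ℝ)) ≤ t := by linarith
  have h₂ : t ≤ 1 - 1 / (4 * (N : ℝ)) := by linarith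
  rw [wiggle_apply, plateau_of_mem hN h₁ h₂, mul_one, abs_mul, abs_of_nonneg hδ₁]
  -- write `2πN t = jπ + u` with `|u| ≤ 2πN w ≤ π/2`
  set u : ℝ := 2 * π * N * (t - j / (2 * N)) with hu_def
  have hsplit : 2 * π * N * t = j * π + u := by
    rw [hu_def]
    field_simp
    ring
  have hu : |u| ≤ 2 * π * N * w := by
    rw [hu_def, abs_mul, abs_of_nonneg (by positivity : (0 : ℝ) ≤ 2 * π * N)]
    gcongr
  have hv : 2 * π * N * w ≤ π := by
    calc 2 * π * N * w ≤ 2 * π * N * (1 / (4 * N)) := by gcongr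
      _ = π / 2 := by field_simp; ring
      _ ≤ π := by linarith [Real.pi_pos]
  rw [hsplit]
  gcongr
  exact cos_le_abs_cos_nat_mul_pi_add j hu hv

/-- **The wiggle near the junctions, with sign** (EM 2001, proof of Lemma 1.3.2): for
`1 ≤ j ≤ 2N - 1`, `w ≤ 1/(4N)` and `|t - j/(2N)| ≤ w`, `δ₁ cos(2πN w) ≤ (-1)ʲ φ_N(t)`: near the
`j`-th junction slice the wiggled core lies in the top half-space for even `j` and in the
bottom one for odd `j`. [cite: EliashbergMishachev2001, Lemma 1.3.2] -/
theorem neg_one_pow_mul_wiggle_ge {N : ℕ} (hN : 0 < N) {δ₁ : ℝ} (hδ₁ : 0 ≤ δ₁) {j : ℕ}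
    (hj₁ : 1 ≤ j) (hj₂ : j + 1 ≤ 2 * N) {t w : ℝ} (hw : w ≤ 1 / (4 * N))
    (ht : |t - j / (2 * N)| ≤ w) :
    δ₁ * Real.cos (2 * π * N * w) ≤ (-1) ^ j * wiggle N δ₁ t := by
  have hN' : (0 : ℝ) < N := by exact_mod_cast hN
  have hj₁' : (1 : ℝ) ≤ j := by exact_mod_cast hj₁
  have hj₂' : (j : ℝ) + 1 ≤ 2 * N := by exact_mod_cast hj₂
  obtain ⟨htl, htu⟩ := abs_sub_le_iff.1 ht
  have hjl : 1 / (2 * (N : ℝ)) ≤ j / (2 * N) := by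
    gcongr
  have hju : (j : ℝ) / (2 * N) ≤ 1 - 1 / (2 * N) := by
    rw [div_le_iff₀ (by positivity : (0 : ℝ) < 2 * N)]
    have : (1 - 1 / (2 * (N : ℝ))) * (2 * N) = 2 * N - 1 := by field_simp
    rw [this]
    linarith
  have hq : 1 / (2 * (N : ℝ)) - 1 / (4 * N) = 1 / (4 * N) := by field_simp; ring
  have h₁ : 1 / (4 * (N : ℝ)) ≤ t := by linarith
  have h₂ : t ≤ 1 - 1 / (4 * (N : ℝ)) := by linarith
  rw [wiggle_apply, plateau_of_mem hN h₁ h₂, mul_one]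
  set u : ℝ := 2 * π * N * (t - j / (2 * N)) with hu_def
  have hsplit : 2 * π * N * t = j * π + u := by
    rw [hu_def]
    field_simp
    ring
  have hu : |u| ≤ 2 * π * N * w := by
    rw [hu_def, abs_mul, abs_of_nonneg (by positivity : (0 : ℝ) ≤ 2 * π * N)]
    gcongr
  have hv : 2 * π * N * w ≤ π := by
    calc 2 * π * N * w ≤ 2 * π * N * (1 / (4 * N)) := by gcongr
      _ = π / 2 := by field_simp; ring
      _ ≤ π := by linarith [Real.pi_pos]
  rw [hsplit, Real.cos_add, Real.cos_nat_mul_pi, Real.sin_nat_mul_pi, zero_mul, sub_zero]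
  have hcos : Real.cos (2 * π * N * w) ≤ Real.cos u := by
    calc Real.cos (2 * π * N * w) ≤ Real.cos |u| :=
          Real.cos_le_cos_of_nonneg_of_le_pi (abs_nonneg u) hv hu
      _ = Real.cos u := Real.cos_abs u
  have hsq : ((-1 : ℝ) ^ j) * (-1) ^ j = 1 := by
    rw [← pow_add, ← two_mul, pow_mul]
    norm_num
  calc δ₁ * Real.cos (2 * π * N * w) ≤ δ₁ * Real.cos u := by gcongr
    _ = (-1) ^ j * (δ₁ * ((-1) ^ j * Real.cos u)) := by
        rw [← mul_assoc, ← mul_assoc, mul_comm ((-1 : ℝ) ^ j) δ₁, mul_assoc δ₁, hsq, mul_one]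

/-! ### Shear maps of `ℝⁿ` -/

/-- Local notation: `𝔼 n` is the model Euclidean space `EuclideanSpace ℝ (Fin n)`. -/
local notation "𝔼 " n:arg => EuclideanSpace ℝ (Fin n)

variable {n : ℕ}

/-- The **shear** of `ℝⁿ` along the coordinate `j` by a function of the coordinate `i`:
`x ↦ x + φ(xᵢ) eⱼ` (EM 2001, Thm. 1.3.1: `h(x) = (x₁, …, xₙ₋₁, xₙ + φ(x₁, …, x_k))`, here with `φ`
depending on one coordinate). [cite: EliashbergMishachev2001, Thm. 1.3.1] -/
def shear (φ : ℝ → ℝ) (i j : Fin n) (x : 𝔼 n) : 𝔼 n :=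
  x + φ (x i) • EuclideanSpace.single j (1 : ℝ)

/-- Unfolding lemma for `shear`. [cite: EliashbergMishachev2001, Thm. 1.3.1] -/
theorem shear_apply (φ : ℝ → ℝ) (i j : Fin n) (x : 𝔼 n) :
    shear φ i j x = x + φ (x i) • EuclideanSpace.single j (1 : ℝ) :=
  rfl

/-- The `j`-th coordinate of the shear: `xⱼ + φ(xᵢ)`. [folklore] -/
theorem shear_apply_same (φ : ℝ → ℝ) (i j : Fin n) (x : 𝔼 n) :
    shear φ i j x j = x j + φ (x i) := by
  simp [shear]

/-- The other coordinates are unchanged by the shear. [folklore] -/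
theorem shear_apply_of_ne (φ : ℝ → ℝ) (i : Fin n) {j k : Fin n} (hkj : k ≠ j) (x : 𝔼 n) :
    shear φ i j x k = x k := by
  simp [shear, hkj]

/-- In particular the shearing coordinate `i ≠ j` is unchanged. [folklore] -/
theorem shear_apply_fst (φ : ℝ → ℝ) {i j : Fin n} (hij : i ≠ j) (x : 𝔼 n) :
    shear φ i j x i = x i :=
  shear_apply_of_ne φ i hij x

/-- Where `φ(xᵢ) = 0` the shear fixes `x`. [folklore] -/
theorem shear_eq_self {φ : ℝ → ℝ} {i j : Fin n} {x : 𝔼 n} (h : φ (x i) = 0) :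
    shear φ i j x = x := by
  simp [shear, h]

/-- The shear by `-φ` undoes the shear by `φ` (`i ≠ j`). [folklore] -/
theorem shear_neg_shear (φ : ℝ → ℝ) {i j : Fin n} (hij : i ≠ j) (x : 𝔼 n) :
    shear (fun s => -φ s) i j (shear φ i j x) = x := by
  rw [shear_apply, shear_apply_fst φ hij, shear_apply, neg_smul, add_neg_cancel_right]

/-- The shear by `φ` undoes the shear by `-φ` (`i ≠ j`). [folklore] -/
theorem shear_shear_neg (φ : ℝ → ℝ) {i j : Fin n} (hij : i ≠ j) (x : 𝔼 n) :
    shear φ i j (shear (fun s => -φ s) i j x) = x := by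
  have := shear_neg_shear (fun s => -φ s) hij x
  simpa using this

/-- The shear is a bijection of `ℝⁿ` (`i ≠ j`). [folklore] -/
theorem bijective_shear (φ : ℝ → ℝ) {i j : Fin n} (hij : i ≠ j) : Bijective (shear φ i j) :=
  ⟨fun x y hxy => by simpa [shear_neg_shear φ hij] using congrArg (shear (fun s => -φ s) i j) hxy,
    fun y => ⟨shear (fun s => -φ s) i j y, shear_shear_neg φ hij y⟩⟩

/-- The shear moves each point by `|φ(xᵢ)|`. [folklore] -/
theorem norm_shear_sub (φ : ℝ → ℝ) (i j : Fin n) (x : 𝔼 n) :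
    ‖shear φ i j x - x‖ = |φ (x i)| := by
  rw [shear_apply, add_sub_cancel_left, norm_smul, Real.norm_eq_abs]
  simp

/-- The shear is `C^k` when `φ` is. [folklore] -/
theorem contDiff_shear {φ : ℝ → ℝ} {k : WithTop ℕ∞} (hφ : ContDiff ℝ k φ) (i j : Fin n) :
    ContDiff ℝ k (shear φ i j) := by
  unfold shear
  exact contDiff_id.add ((hφ.comp (EuclideanSpace.proj i).contDiff).smul contDiff_const)

/-- The shear is continuous when `φ` is. [folklore] -/
theorem continuous_shear {φ : ℝ → ℝ} (hφ : Continuous φ) (i j : Fin n) :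
    Continuous (shear φ i j) := by
  unfold shear
  exact continuous_id.add ((hφ.comp (EuclideanSpace.proj i).continuous).smul continuous_const)

/-- **Derivative of the shear**: `D(shear)_x = id + φ'(xᵢ) eⱼ ⊗ eᵢ*`. [folklore] -/
theorem hasFDerivAt_shear {φ : ℝ → ℝ} {φ' : ℝ} {i j : Fin n} {x : 𝔼 n}
    (hφ : HasDerivAt φ φ' (x i)) :
    HasFDerivAt (shear φ i j) (ContinuousLinearMap.id ℝ (𝔼 n) +
      (φ' • (EuclideanSpace.proj i : 𝔼 n →L[ℝ] ℝ)).smulRight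
        (EuclideanSpace.single j (1 : ℝ))) x := by
  have h1 : HasFDerivAt (fun y : 𝔼 n => φ ((EuclideanSpace.proj i : 𝔼 n →L[ℝ] ℝ) y))
      (φ' • (EuclideanSpace.proj i : 𝔼 n →L[ℝ] ℝ)) x :=
    hφ.comp_hasFDerivAt x (EuclideanSpace.proj i : 𝔼 n →L[ℝ] ℝ).hasFDerivAt
  exact (hasFDerivAt_id x).add (h1.smul_const _)

end Literature.Topology.Immersions
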